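import Summits.Ventures.HSemireg.WedgeHankelRecurrenceSymbol

/-!
# Venture HSemireg — THE ACTION OF `K[X]` ON CLASSES: applying the recurrence operator `p(σ)` to the class of the symbol `a / m` gives the class of `p a / m` (`⟪p, dualSeq m a⟫_s =
# dualSeq m (p a) s`), so by Kronecker (N45) **`R(p · q) = deg m − deg gcd(m, p)` for a reduced class `q = dualSeq m a`: the operator `p(σ)` kills exactly the part of the apolar
# scheme on `{p = 0}`**; in particular **`(σ − λ)` lowers the middle rank by one iff `λ` is a node (`m(λ) = 0`) and keeps it otherwise**, and `m(σ)` kills the class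

HONEST FRAMING. Part of the Lean index of the computation cell `pub-hsemireg` (seat p10 gen 28, Sunday typer «UNIFORM-IN-n»).
LINEAR ALGEBRA OF HANKEL (catalecticant) MATRICES and of polynomials over a field ONLY: no variety, no cohomology theory, no sheaf, no Ext group and no semiregularity map is constructed
here; nothing here says that HC / HC_CM / HC_AV holds; no Literature fact is declared or used.  Custodian versions as in `WedgeHankelSiegelIdeal` (1/3); the dictionary (`⟪p, q⟫_s` = the
`s`-th term of `p(σ) q`, `σ` the shift, N18; «finite differences `(E − λ)` annihilate `λ^n`») is QUOTED, never asserted.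

WHAT IS KEYED / IN THE TREE.  N45 (`WedgeHankelRecurrenceSymbol`, p10 g28 claim #3 = № 327): `rank_hankel1_half_dualSeq_eq_sub_natDegree_gcd`, `natDegree_gcd_eq_zero_of_isCoprime`;
N32 (№ 263): `dualSeq`, `dualSeq_apply`, `hkFun_dualSeq`, `dualSeq_eq_zero_of_dvd`, `rank_hankel1_half_dualSeq_of_isCoprime`; N18 (№ 173) `hkFun`.  Mathlib: `EuclideanDomain.gcd`,
`EuclideanDomain.dvd_gcd`, `Polynomial.natDegree_le_of_dvd`, `Polynomial.irreducible_X_sub_C`, `Irreducible.coprime_iff_not_dvd`, `Polynomial.dvd_iff_isRoot`, `IsCoprime.dvd_of_dvd_mul_right`.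
THIS FILE (namespace `Summit.Ventures.HSemireg.Wedge.HankelOuter` continued; CHAINED on N45; 0 definitions):
* §561 **`hkFun_dualSeq_eq_dualSeq_mul`** (`⟪p, dualSeq m a⟫_s = dualSeq m (p · a) s`: `p(σ)` acts on symbols by multiplication of the numerator), `dualSeq_mul_self_left` (`m(σ)` kills).
* §562 `natDegree_gcd_mul_eq_of_isCoprime` (`a` a unit mod `m ⇒ deg gcd(m, p a) = deg gcd(m, p)`), **`rank_hankel1_half_dualSeq_mul`** (`2 deg m ≤ N + 1`, `IsCoprime m a ⇒
  R(dualSeq m (p a)) = deg m − deg gcd(m, p)`), `rank_hankel1_half_dualSeq_mul_of_isCoprime` (`p` a unit mod `m`: the rank is kept), `rank_hankel1_half_dualSeq_mul_le` (never raised).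
* §563 one linear factor: `natDegree_gcd_X_sub_C` (`deg gcd(m, X − λ) = 1` if `m(λ) = 0`, else `0`), **`rank_hankel1_half_dualSeq_X_sub_C_mul`** (`R(dualSeq m ((X − λ) a)) = deg m − 1`
  if `m(λ) = 0`, `= deg m` otherwise: `σ − λ` removes exactly the node at `λ`).
Nothing Ext-side.  New names only.
-/

open Module Polynomial
open scoped Matrix Polynomial

namespace Summit.Ventures.HSemireg.Wedge.HankelOuter

open Summit.Ventures.HSemireg.Wedge Summit.Ventures.HSemireg.Wedge.Hankel

variable (K : Type*) [Field K] {N : ℕ}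

/-! ## §561. `p(σ)` acts on symbols by multiplication of the numerator -/

/-- **`⟪p, dualSeq m a⟫_s = dualSeq m (p · a) s`**: the recurrence operator `p(σ)` sends the class of `a / m` to the class of `p a / m`. -/
theorem hkFun_dualSeq_eq_dualSeq_mul (m a p : K[X]) (s : ℕ) : hkFun K (dualSeq K m a) s p = dualSeq K m (p * a) s := by
  rw [hkFun_dualSeq, dualSeq_apply]

/-- `m(σ)` kills the class of `a / m`: `dualSeq m (m · a) = 0` (`m` monic). -/
theorem dualSeq_mul_self_left {m : K[X]} (hm : m.Monic) (a : K[X]) : dualSeq K m (m * a) = 0 :=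
  dualSeq_eq_zero_of_dvd K hm (dvd_mul_right m a)

/-! ## §562. The middle rank after the action: Kronecker for `p a / m` -/

/-- for `a` a unit modulo `m`, `gcd(m, p a)` and `gcd(m, p)` have the same degree (they divide each other). -/
theorem natDegree_gcd_mul_eq_of_isCoprime [DecidableEq K] {m a : K[X]} (hm0 : m ≠ 0) (hcop : IsCoprime m a) (p : K[X]) :
    (EuclideanDomain.gcd m (p * a)).natDegree = (EuclideanDomain.gcd m p).natDegree := by
  have hg0 : EuclideanDomain.gcd m (p * a) ≠ 0 := fun h => hm0 ((EuclideanDomain.gcd_eq_zero_iff.mp h).1)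
  have hg0' : EuclideanDomain.gcd m p ≠ 0 := fun h => hm0 ((EuclideanDomain.gcd_eq_zero_iff.mp h).1)
  refine le_antisymm (Polynomial.natDegree_le_of_dvd ?_ hg0') (Polynomial.natDegree_le_of_dvd ?_ hg0)
  · refine EuclideanDomain.dvd_gcd (EuclideanDomain.gcd_dvd_left _ _) ?_
    exact (hcop.of_isCoprime_of_dvd_left (EuclideanDomain.gcd_dvd_left m (p * a))).dvd_of_dvd_mul_right (EuclideanDomain.gcd_dvd_right m (p * a))
  · exact EuclideanDomain.dvd_gcd (EuclideanDomain.gcd_dvd_left _ _) ((EuclideanDomain.gcd_dvd_right m p).trans (dvd_mul_right p a))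

/-- **KRONECKER AFTER THE ACTION: for `m` monic, `a` a unit modulo `m` and `2 deg m ≤ N + 1`, `R(dualSeq m (p · a)) = deg m − deg gcd(m, p)`** — `p(σ)` removes exactly the part of
the apolar scheme lying on `{p = 0}`. -/
theorem rank_hankel1_half_dualSeq_mul [DecidableEq K] {m a : K[X]} (hm : m.Monic) (hcop : IsCoprime m a) (h2 : m.natDegree + m.natDegree ≤ N + 1) (p : K[X]) :
    (hankel1 K N (N / 2) (dualSeq K m (p * a))).rank = m.natDegree - (EuclideanDomain.gcd m p).natDegree := by
  rw [rank_hankel1_half_dualSeq_eq_sub_natDegree_gcd K hm h2, natDegree_gcd_mul_eq_of_isCoprime K hm.ne_zero hcop]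

/-- `p` a unit modulo `m`: the action keeps the middle rank. -/
theorem rank_hankel1_half_dualSeq_mul_of_isCoprime [DecidableEq K] {m a : K[X]} (hm : m.Monic) (hcop : IsCoprime m a) (h2 : m.natDegree + m.natDegree ≤ N + 1) {p : K[X]}
    (hp : IsCoprime m p) : (hankel1 K N (N / 2) (dualSeq K m (p * a))).rank = m.natDegree := by
  rw [rank_hankel1_half_dualSeq_mul K hm hcop h2, natDegree_gcd_eq_zero_of_isCoprime K hp, Nat.sub_zero]

/-- the action never raises the middle rank: `R(dualSeq m (p a)) ≤ R(dualSeq m a) = deg m`. -/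
theorem rank_hankel1_half_dualSeq_mul_le [DecidableEq K] {m a : K[X]} (hm : m.Monic) (hcop : IsCoprime m a) (h2 : m.natDegree + m.natDegree ≤ N + 1) (p : K[X]) :
    (hankel1 K N (N / 2) (dualSeq K m (p * a))).rank ≤ (hankel1 K N (N / 2) (dualSeq K m a)).rank := by
  rw [rank_hankel1_half_dualSeq_mul K hm hcop h2, rank_hankel1_half_dualSeq_of_isCoprime K hm hcop h2]
  exact Nat.sub_le _ _

/-! ## §563. One linear factor: `σ − λ` removes exactly the node at `λ` -/

/-- `deg gcd(m, X − λ) = 1` if `λ` is a root of `m`, `0` otherwise (`m ≠ 0`). -/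
theorem natDegree_gcd_X_sub_C [DecidableEq K] {m : K[X]} (hm0 : m ≠ 0) (c : K) :
    (EuclideanDomain.gcd m (Polynomial.X - Polynomial.C c)).natDegree = if m.IsRoot c then 1 else 0 := by
  split_ifs with hroot
  · -- `X − c ∣ m`, so the gcd is `X − c` up to a unit
    have hdvd : Polynomial.X - Polynomial.C c ∣ m := Polynomial.dvd_iff_isRoot.mpr hroot
    have hg0 : EuclideanDomain.gcd m (Polynomial.X - Polynomial.C c) ≠ 0 := fun h => hm0 ((EuclideanDomain.gcd_eq_zero_iff.mp h).1)
    refine le_antisymm ?_ ?_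
    · have := Polynomial.natDegree_le_of_dvd (EuclideanDomain.gcd_dvd_right m (Polynomial.X - Polynomial.C c)) (Polynomial.X_sub_C_ne_zero c)
      rwa [Polynomial.natDegree_X_sub_C] at this
    · have := Polynomial.natDegree_le_of_dvd (EuclideanDomain.dvd_gcd hdvd (dvd_refl _)) hg0
      rwa [Polynomial.natDegree_X_sub_C] at this
  · rw [← Polynomial.dvd_iff_isRoot, (Polynomial.irreducible_X_sub_C c).dvd_iff_not_isCoprime, not_not] at hroot
    exact natDegree_gcd_eq_zero_of_isCoprime K hroot.symm

/-- **`σ − λ` REMOVES EXACTLY THE NODE AT `λ`: for `m` monic, `a` a unit modulo `m` and `2 deg m ≤ N + 1`, the class `(σ − λ)·(a / m) = ((X − λ) a) / m` has middle rank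
`deg m − 1` if `m(λ) = 0` and `deg m` otherwise.** -/
theorem rank_hankel1_half_dualSeq_X_sub_C_mul [DecidableEq K] {m a : K[X]} (hm : m.Monic) (hcop : IsCoprime m a) (h2 : m.natDegree + m.natDegree ≤ N + 1) (c : K) :
    (hankel1 K N (N / 2) (dualSeq K m ((Polynomial.X - Polynomial.C c) * a))).rank = if m.IsRoot c then m.natDegree - 1 else m.natDegree := by
  rw [rank_hankel1_half_dualSeq_mul K hm hcop h2, natDegree_gcd_X_sub_C K hm.ne_zero]
  split_ifs <;> simp

end Summit.Ventures.HSemireg.Wedge.HankelOuter
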